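import Summits.HubbardSuperconductivity.HubbardSuperconductivity.Theses.ThermalWedge
import Summits.HubbardSuperconductivity.HubbardSuperconductivity.Theses.TorusCooperLog
import Summits.HubbardSuperconductivity.HubbardSuperconductivity.Theses.IntrinsicLargeN
import Summits.HubbardSuperconductivity.HubbardSuperconductivity.Theorems.ThermalWedgeTwTipContinuationCrossRoute
import Summits.HubbardSuperconductivity.HubbardSuperconductivity.Theorems.ThermalWedgeTwTipContinuationIsogapResiduals
import Summits.HubbardSuperconductivity.HubbardSuperconductivity.Theorems.IntrinsicLargeNGlue
import Summits.HubbardSuperconductivity.HubbardSuperconductivity.Theorems.IntrinsicLargeNReducedBCSAnchor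
import HarnessLib

/-!
# `TwTipContinuation` (stmt-HubbardSuperconductivity-1700) — crux-strategist pass r1 (EXEMPT-46 answer):
# the candidate DIVISIONS of the crux, kernel-checked, and why none is registered

Companion of `Cruxes/TwTipContinuation/STRATEGY-CENSUS.md` (gen 2, pass r1, 2026-08-17).  The crux is
`USW` (p85630 `twTipContinuation_iff_uniformSummitWindow`: the `U`-uniform every-ground-state
`d_{x²-y²}` order window of the PURE torus at one `δ ∈ [1/10,2/5]`).  The EXEMPT-46 re-exam judged the
registered division D1 = MECHANISM (`KLCanonical`, stmt-2681) + DATUM (line `kl-mechanism-datum`)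
PIECE-EQUIVALENT / TRIVIAL-SEAM.  This file records, sorry-free, the two other divisions of `USW` that
are typable over the tree today with BOTH pieces strictly below `USW`, so that the census can quote
their assemblies verbatim:

* σ2 (the disprover's canonical corner division, `Disproof.lean` §14 `corner_summary`):
  `ExistsGSOrderWindow ∧ GroundHomogeneityWindow → TwTipContinuation`
  (`twTipContinuation_of_exists_of_homogeneity`; the seam is ∃-elimination + instantiation of the
  homogeneity piece at the ordered ground state, then the landed normal form p85630);
* D4 (route `IntrinsicLargeN`'s two halves transported to the wedge window):
  `PairSectorShadow (stmt-10970) ∧ GroundEigenspaceHomogeneity (stmt-10971) ∧ DatumInWindow →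
  TwTipContinuation` (`twTipContinuation_of_intrinsicLargeN_halves`, over the LANDED supports
  `reducedBCSAnchor_proof`, `shadowCondensation_proof`; the seam is route `IntrinsicLargeN`'s own
  deciding arithmetic with `U` kept universal, then p92871's open-window normal form);
  and `existsGSOrderWindow_of_pairSectorShadow`: D4's ∃-half at the datum IS an ∃-GS order window
  (σ2's piece 1), as its own why-might-fail says;
* for comparison D1: `KLCanonical → DatumInWindow → TwTipContinuation` is p92871 verbatim
  (`twTipContinuation_of_klCanonical'`).

Nothing here is proposed as a Theorems file and no item is filed: σ2/D4 are the TOP LAYER of route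
`IntrinsicLargeN` (and, in trace-average form, of route `BalabanIR`), exactly as D1 is the top layer of
route `TorusCooperLog`; their seams are instantiation-grade by the standard that classed D1's adapter
chain TRIVIAL-SEAM.  See the census §3–§5 for the verdict table.  Folklore logic over landed files;
no definition is introduced into the tree (the three `def`s below are local abbreviations of statement
shapes already present in `Disproof.lean` §14–§15 / `Lines/kl_mechanism_datum.lean`). [folklore]
-/

noncomputable section

set_option linter.dupNamespace false

namespace Summit.HubbardSuperconductivity.HubbardSuperconductivity.Cruxes.TwTipContinuation.StrategistR1

open Literature.MathematicalPhysics.QuantumLattice Literature.Probability.LatticeModels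
open Summit.HubbardSuperconductivity.HubbardSuperconductivity.Theses.ThermalWedge (TwTipContinuation)
open Summit.HubbardSuperconductivity.HubbardSuperconductivity.Theses.IntrinsicLargeN
  (PairSectorShadow GroundEigenspaceHomogeneity ReducedBCSAnchor ShadowCondensation)
open Summit.HubbardSuperconductivity.HubbardSuperconductivity.Theses.TorusCooperLog (KLCanonical)
open scoped Matrix ComplexOrder

/-! ### The pieces (local abbreviations of existing statement shapes) -/

/-- **σ2 piece 1 — the `∃`-ground-state order window** (= `Disproof.lean` §15 `ExistsGSOrderWindow`,
spelled over Literature terms): one `δ ∈ [1/10,2/5]`, all `U ∈ (0,U₁]`, eventually in even `L`, SOME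
normalised sector ground state of the pure torus has `c(U)·L⁴ ≤ re⟨Δ_dᴴΔ_d⟩`. Open (weak-coupling
Kohn–Luttinger d-wave order as a theorem, in its variational form). [folklore] -/
def ExistsGSOrderWindow : Prop :=
  ∃ U₁ : ℝ, 0 < U₁ ∧ ∃ δ ∈ Set.Icc (1 / 10 : ℝ) (2 / 5), ∀ U ∈ Set.Ioc (0 : ℝ) U₁,
    ∃ c : ℝ, 0 < c ∧ ∃ L₀ : ℕ, ∀ (L : ℕ) [NeZero L], L₀ ≤ L → Even L →
      ∃ ψ : Fock (Orb (FermionTorus 2 L)), star ψ ⬝ᵥ ψ = 1 ∧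
        IsGroundStateInSector (hubbardTorus 2 L 1 U) (2 * ⌊(1 - δ) * (L : ℝ) ^ 2 / 2⌋₊) 0 ψ ∧
          c * (L : ℝ) ^ 4 ≤ (expect ((pairField dWaveFormFactor L)ᴴ * pairField dWaveFormFactor L) ψ).re

/-- **σ2 piece 2 — ε-homogeneity of the sector ground eigenspace on the window** (the shape of the
registered-and-blocked stub `stub_groundSpaceHomogeneity` of line `isogap-submodular-transport`): for
every doping of the window and all small `U`, any two normalised sector ground states have d-wave pair
intensities within `εL⁴`, eventually in even `L`, for every `ε > 0`. Open (absence of accidental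
ground degeneracy with macroscopically different pair order, for EVERY small `U`). [folklore] -/
def GroundHomogeneityWindow : Prop :=
  ∀ δ ∈ Set.Icc (1 / 10 : ℝ) (2 / 5), ∃ U₁ : ℝ, 0 < U₁ ∧ ∀ U ∈ Set.Ioc (0 : ℝ) U₁, ∀ ε : ℝ, 0 < ε →
    ∃ L₀ : ℕ, ∀ (L : ℕ) [NeZero L], L₀ ≤ L → Even L →
      ∀ ψ ψ' : Fock (Orb (FermionTorus 2 L)), star ψ ⬝ᵥ ψ = 1 → star ψ' ⬝ᵥ ψ' = 1 →
        IsGroundStateInSector (hubbardTorus 2 L 1 U) (2 * ⌊(1 - δ) * (L : ℝ) ^ 2 / 2⌋₊) 0 ψ →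
        IsGroundStateInSector (hubbardTorus 2 L 1 U) (2 * ⌊(1 - δ) * (L : ℝ) ^ 2 / 2⌋₊) 0 ψ' →
          (expect ((pairField dWaveFormFactor L)ᴴ * pairField dWaveFormFactor L) ψ).re ≤
            (expect ((pairField dWaveFormFactor L)ᴴ * pairField dWaveFormFactor L) ψ').re + ε * (L : ℝ) ^ 4

/-- **The Kohn–Luttinger `B₁g` datum INSIDE the wedge window** (two-clause form; the signature of the
moot item stmt-15257 / the output of `KlMechanismDatum.certB1gWedge_of_leads`). Certifiable by
interval arithmetic (lead c5's wave). [cite: RaghuKivelsonScalapino2010, §III Fig. 2] -/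
def DatumInWindow : Prop :=
  ∃ δ ∈ Set.Icc (1 / 10 : ℝ) (2 / 5), ∃ γ U₁ : ℝ, 0 < γ ∧ 0 < U₁ ∧ ∀ U ∈ Set.Ioo (0:ℝ) U₁,
    channelInf (squareDispersion 1 0) (chemicalPotentialOfDensity (squareDispersion 1 0) (1 - δ)) U
        D4Irrep.B1g ≤ -(γ * U ^ 2) ∧
      ∀ χ : D4Irrep, χ ≠ D4Irrep.B1g →
        channelInf (squareDispersion 1 0) (chemicalPotentialOfDensity (squareDispersion 1 0) (1 - δ)) U
            D4Irrep.B1g + γ * U ^ 2 ≤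
          channelInf (squareDispersion 1 0) (chemicalPotentialOfDensity (squareDispersion 1 0) (1 - δ)) U χ

/-! ### σ2 — the canonical corner division: assembly and its seam -/

/-- **σ2 assembly.** `ExistsGSOrderWindow → GroundHomogeneityWindow → TwTipContinuation`: at the
ordered doping take `U ≤ min U₁ U₂`; homogeneity at `ε = c/2` instantiated at (any GS, the ordered GS)
gives every GS `≥ (c/2)L⁴` (`everyGSOrder_of_existsGSOrder_of_homogeneity`, p97433); the every-GS
window is the crux by p85630. The seam between the two OPEN pieces is one instantiation. [folklore] -/
theorem twTipContinuation_of_exists_of_homogeneity (h₁ : ExistsGSOrderWindow)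
    (h₂ : GroundHomogeneityWindow) : TwTipContinuation := by
  obtain ⟨U₁, hU₁, δ, hδ, hord⟩ := h₁
  obtain ⟨U₂, hU₂, hhom⟩ := h₂ δ hδ
  refine (Summit.HubbardSuperconductivity.TwTipContinuation.AnchorDischarge.twTipContinuation_iff_everyGSOrder_window).2
    ⟨min U₁ U₂, lt_min hU₁ hU₂, δ, hδ, fun U hU => ?_⟩
  have hU1 : U ∈ Set.Ioc (0 : ℝ) U₁ := ⟨hU.1, hU.2.trans (min_le_left _ _)⟩
  have hU2 : U ∈ Set.Ioc (0 : ℝ) U₂ := ⟨hU.1, hU.2.trans (min_le_right _ _)⟩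
  obtain ⟨c, hc, L₁, hex⟩ := hord U hU1
  obtain ⟨L₂, hhom'⟩ := hhom U hU2 (c / 2) (by positivity)
  refine ⟨c / 2, by positivity, max L₁ L₂, fun L _ hL hEv ψ hψ hgs => ?_⟩
  have hL₁ : L₁ ≤ L := le_trans (le_max_left _ _) hL
  have hL₂ : L₂ ≤ L := le_trans (le_max_right _ _) hL
  have key :=
    Summit.HubbardSuperconductivity.TwTipContinuation.IsogapTransport.everyGSOrder_of_existsGSOrder_of_homogeneity
      L U c (c / 2) _ (hex L hL₁ hEv) (hhom' L hL₂ hEv) ψ hψ hgs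
  have : (c - c / 2) * (L : ℝ) ^ 4 = c / 2 * (L : ℝ) ^ 4 := by ring
  linarith

/-! ### D4 — route `IntrinsicLargeN`'s halves transported to the wedge window -/

/-- **D4's `∃`-half at the datum is an `∃`-GS order window** (σ2 piece 1): `PairSectorShadow`
(stmt-10970) + the in-window datum, over the LANDED `ReducedBCSAnchor` (p: `reducedBCSAnchor_proof`)
and `ShadowCondensation` (`shadowCondensation_proof`): the shadow `φ` of the ordered ground state `ψ₀`
captures `(1-ε)` of the reduced-BCS condensation energy `c(g)L²`, hence carries LRO
`≥ (1-ε)(c/g)L⁴`, and `ψ₀ ≥ (1-θ)·` that. [folklore] -/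
theorem existsGSOrderWindow_of_pairSectorShadow (h1 : PairSectorShadow) (hd : DatumInWindow) :
    ExistsGSOrderWindow := by
  have hA : ReducedBCSAnchor :=
    Summit.HubbardSuperconductivity.HubbardSuperconductivity.Theorems.IntrinsicLargeN.reducedBCSAnchor_proof
  have h3 : ShadowCondensation :=
    Summit.HubbardSuperconductivity.HubbardSuperconductivity.Theorems.IntrinsicLargeN.shadowCondensation_proof
  obtain ⟨δ, hδ, γ, U₁, hγ, hU₁, hdom⟩ := hd
  have hδ' : δ ∈ Set.Ioo (0:ℝ) (1/2) := ⟨by linarith [hδ.1], by linarith [hδ.2]⟩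
  have hδ1 : δ ∈ Set.Ioo (0:ℝ) 1 := ⟨hδ'.1, by linarith [hδ.2]⟩
  obtain ⟨κ, hκ, U₂, hU₂, hS⟩ := h1 δ hδ' γ U₁ hγ hU₁ hdom
  refine ⟨U₂ / 2, half_pos hU₂, δ, hδ, fun U hU => ?_⟩
  have hU2 : U ∈ Set.Ioo (0:ℝ) U₂ := ⟨hU.1, lt_of_le_of_lt hU.2 (half_lt_self hU₂)⟩
  obtain ⟨g, hg, ε, θ, hε, hθ, L₁, hL₁⟩ := hS U hU2
  have hκU : 0 < κ * U ^ 2 := by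
    have := hU.1
    positivity
  have hgpos : 0 < g := lt_of_lt_of_le hκU hg
  obtain ⟨c, hc, L₃, hL₃⟩ := hA g hgpos δ hδ1
  have h2' : 0 < 1 - θ := by linarith
  have h3' : 0 < 1 - ε := by linarith
  refine ⟨(1 - θ) * ((1 - ε) * (c / g)), by positivity, max L₁ L₃, ?_⟩
  intro L inst hL hEven
  have hL1 : L₁ ≤ L := le_trans (le_max_left _ _) hL
  have hL3 : L₃ ≤ L := le_trans (le_max_right _ _) hL
  obtain ⟨ψ₀, hψ₀, hGS₀, φ, hφS, hφ1, hφE, hφLRO⟩ := hL₁ L hL1 hEven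
  have hanchor := hL₃ L hL3 hEven
  have h3c := h3 g hgpos L (2 * ⌊(1 - δ) * (L : ℝ) ^ 2 / 2⌋₊) (c * (L : ℝ) ^ 2) ε φ hε.le hφ1 hφS hanchor hφE
  refine ⟨ψ₀, hψ₀, hGS₀, ?_⟩
  calc (1 - θ) * ((1 - ε) * (c / g)) * (L : ℝ) ^ 4
      = (1 - θ) * ((1 - ε) * ((L : ℝ) ^ 2 * (c * (L : ℝ) ^ 2) / g)) := by ring
    _ ≤ (1 - θ) * (expect ((pairField dWaveFormFactor L)ᴴ * pairField dWaveFormFactor L) φ).re :=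
        mul_le_mul_of_nonneg_left h3c h2'.le
    _ ≤ _ := hφLRO

/-- **D4 assembly.** `PairSectorShadow (stmt-10970) → GroundEigenspaceHomogeneity (stmt-10971) →
DatumInWindow → TwTipContinuation`: route `IntrinsicLargeN`'s deciding arithmetic
(`a = (1-θ')(1-θ)(1-ε)c/g`) with `U` kept universal on `(0, min U₂ U₃)` at the datum's doping, then the
open-window normal form of the crux (p92871 `twTipContinuation_iff_everyGSOrderOpenWindow`). The seam
between the two OPEN halves is the instantiation of homogeneity at `(ψ, ψ₀)`. [folklore] -/
theorem twTipContinuation_of_intrinsicLargeN_halves (h1 : PairSectorShadow)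
    (h2 : GroundEigenspaceHomogeneity) (hd : DatumInWindow) : TwTipContinuation := by
  have hA : ReducedBCSAnchor :=
    Summit.HubbardSuperconductivity.HubbardSuperconductivity.Theorems.IntrinsicLargeN.reducedBCSAnchor_proof
  have h3 : ShadowCondensation :=
    Summit.HubbardSuperconductivity.HubbardSuperconductivity.Theorems.IntrinsicLargeN.shadowCondensation_proof
  obtain ⟨δ, hδ, γ, U₁, hγ, hU₁, hdom⟩ := hd
  have hδ' : δ ∈ Set.Ioo (0:ℝ) (1/2) := ⟨by linarith [hδ.1], by linarith [hδ.2]⟩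
  have hδ1 : δ ∈ Set.Ioo (0:ℝ) 1 := ⟨hδ'.1, by linarith [hδ.2]⟩
  obtain ⟨κ, hκ, U₂, hU₂, hS⟩ := h1 δ hδ' γ U₁ hγ hU₁ hdom
  obtain ⟨U₃, hU₃, hH⟩ := h2 δ hδ' γ U₁ hγ hU₁ hdom
  refine (Summit.HubbardSuperconductivity.TwTipContinuation.CrossRoute.twTipContinuation_iff_everyGSOrderOpenWindow).2
    ⟨δ, hδ, min U₂ U₃, lt_min hU₂ hU₃, fun U hU => ?_⟩
  have hU2 : U ∈ Set.Ioo (0:ℝ) U₂ := ⟨hU.1, lt_of_lt_of_le hU.2 (min_le_left _ _)⟩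
  have hU3 : U ∈ Set.Ioo (0:ℝ) U₃ := ⟨hU.1, lt_of_lt_of_le hU.2 (min_le_right _ _)⟩
  obtain ⟨g, hg, ε, θ, hε, hθ, L₁, hL₁⟩ := hS U hU2
  obtain ⟨θ', hθ', L₂, hL₂⟩ := hH U hU3
  have hκU : 0 < κ * U ^ 2 := by
    have := hU.1
    positivity
  have hgpos : 0 < g := lt_of_lt_of_le hκU hg
  obtain ⟨c, hc, L₃, hL₃⟩ := hA g hgpos δ hδ1
  have h1' : 0 < 1 - θ' := by linarith
  have h2' : 0 < 1 - θ := by linarith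
  have h3' : 0 < 1 - ε := by linarith
  refine ⟨(1 - θ') * ((1 - θ) * ((1 - ε) * (c / g))), by positivity, max L₁ (max L₂ L₃), ?_⟩
  intro L inst hL hEven ψ hψ hGS
  have hL1 : L₁ ≤ L := le_trans (le_max_left _ _) hL
  have hL2 : L₂ ≤ L := le_trans (le_trans (le_max_left _ _) (le_max_right _ _)) hL
  have hL3 : L₃ ≤ L := le_trans (le_trans (le_max_right _ _) (le_max_right _ _)) hL
  obtain ⟨ψ₀, hψ₀, hGS₀, φ, hφS, hφ1, hφE, hφLRO⟩ := hL₁ L hL1 hEven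
  have hanchor := hL₃ L hL3 hEven
  have h3c := h3 g hgpos L (2 * ⌊(1 - δ) * (L : ℝ) ^ 2 / 2⌋₊) (c * (L : ℝ) ^ 2) ε φ hε.le hφ1 hφS hanchor hφE
  have hhom := hL₂ L hL2 hEven ψ ψ₀ hψ hψ₀ hGS hGS₀
  calc (1 - θ') * ((1 - θ) * ((1 - ε) * (c / g))) * (L : ℝ) ^ 4
      = (1 - θ') * ((1 - θ) * ((1 - ε) * ((L : ℝ) ^ 2 * (c * (L : ℝ) ^ 2) / g))) := by ring
    _ ≤ (1 - θ') * ((1 - θ) * (expect ((pairField dWaveFormFactor L)ᴴ * pairField dWaveFormFactor L) φ).re) :=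
        mul_le_mul_of_nonneg_left (mul_le_mul_of_nonneg_left h3c h2'.le) h1'.le
    _ ≤ (1 - θ') * (expect ((pairField dWaveFormFactor L)ᴴ * pairField dWaveFormFactor L) ψ₀).re :=
        mul_le_mul_of_nonneg_left hφLRO h1'.le
    _ ≤ _ := hhom

/-! ### D1 for comparison (the division the re-exam rejected) -/

/-- **D1 assembly** (= p92871 `CrossRoute.twTipContinuation_of_klCanonical`, restated over the local
datum abbreviation): `KLCanonical (stmt-2681) → DatumInWindow → TwTipContinuation`. The seam is modus
ponens (the datum is the hypothesis of the mechanism). [folklore] -/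
theorem twTipContinuation_of_klCanonical' (h : KLCanonical) (hd : DatumInWindow) : TwTipContinuation :=
  Summit.HubbardSuperconductivity.TwTipContinuation.CrossRoute.twTipContinuation_of_klCanonical h hd

end Summit.HubbardSuperconductivity.HubbardSuperconductivity.Cruxes.TwTipContinuation.StrategistR1

end
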